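import Summits.Parity.BatemanHorn.Theorems.BalancedSemiprimeLayer.Negative.RoughLayerAsymptotics

/-!
# `BalancedSemiprimeLayer` (crux stmt-Parity-9469): tightness at the Bateman–Horn system `(X)`

Negative-side tightness results (cdisprove, refuter-cdisprove-stmt-Parity-9469-g2-0), all PROVED:

* `isBatemanHornSystem_X` — `(X)` is a Bateman–Horn system (`ω(p) = 1`);
* `layer_X_eventually_gt` / `layer_X_eventually_lt` — two-sided eventual bounds: the crux's excess
  `Φ_{(X)}(x, δ) − P_{(X)}(x)` lies between `c·x/log x` for every `c < log((1+δ)/(1−δ))` and every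
  `c > log((1+δ)/(1−δ))`;
* `log_ratio_le_of_eventually_cruxIneq_X`, `two_mul_delta_le_of_eventually_cruxIneq_X` — if the
  crux inequality holds eventually at `(X)` with the pair `(ε, δ)` then `log((1+δ)/(1−δ)) ≤ ε`, in
  particular **`2δ ≤ ε`**: the admissible `δ(ε)` is `O(ε)` — exactly the heuristic threshold
  `2kδ·C(f)/∏deg fᵢ ≤ ε` at `k = 1`, `C(X) = 1` — and the tolerance `εx/(log x)^k` cannot be lowered
  in order of magnitude;
* `cruxConclusion_X` — the POSITIVE instance: the crux's conclusion HOLDS for `(X)` with the explicit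
  choice `δ(ε) = min (1/4) (ε/4)` (template for the all-linear layer).
-/

namespace Summit.Parity.BatemanHorn.Theorems.BalancedSemiprimeLayer.Negative

open Filter Finset Polynomial Real
open scoped Topology
open Literature.NumberTheory.Sieve

/-! ### The system `(X)` -/

/-- `#{n < p : p ∣ n} = 1` for a prime `p`. [folklore] -/
theorem card_filter_range_dvd {p : ℕ} (hp : p.Prime) :
    #((range p).filter (fun n : ℕ => p ∣ n)) = 1 := by
  rw [Finset.card_eq_one]
  refine ⟨0, ?_⟩
  ext n
  simp only [mem_filter, mem_range, mem_singleton]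
  constructor
  · rintro ⟨hn, hpn⟩
    exact Nat.eq_zero_of_dvd_of_lt hpn hn
  · rintro rfl
    exact ⟨hp.pos, dvd_zero p⟩

/-- `#{n < p : p ∣ n·n} = 1` for a prime `p`. [folklore] -/
theorem card_filter_range_dvd_mul_self {p : ℕ} (hp : p.Prime) :
    #((range p).filter (fun n : ℕ => (p : ℤ) ∣ (n : ℤ) * (n : ℤ))) = 1 := by
  have h : ∀ n : ℕ, ((p : ℤ) ∣ (n : ℤ) * (n : ℤ)) ↔ p ∣ n := by
    intro n
    rw [← Nat.cast_mul, Int.natCast_dvd_natCast]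
    exact ⟨fun h => (hp.dvd_mul.mp h).elim id id, fun h => h.mul_right n⟩
  simp_rw [h]
  exact card_filter_range_dvd hp

/-- `ω_{(X)}(p) = 1`. [folklore] -/
theorem polyRootCountMod_X {p : ℕ} (hp : p.Prime) :
    polyRootCountMod ![(X : ℤ[X])] p = 1 := by
  unfold polyRootCountMod
  have h : ∀ n : ℕ, ((p : ℤ) ∣ ∏ i, (![(X : ℤ[X])] i).eval (n : ℤ)) ↔ p ∣ n := by
    intro n
    simp only [Fin.prod_univ_one, Matrix.cons_val_fin_one, eval_X]
    exact Int.natCast_dvd_natCast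
  simp_rw [h]
  exact card_filter_range_dvd hp

/-- The system `(X)` is a Bateman–Horn system. [folklore] -/
theorem isBatemanHornSystem_X : IsBatemanHornSystem ![(X : ℤ[X])] where
  irreducible i := by
    fin_cases i
    exact irreducible_X
  leadingCoeff_pos i := by
    fin_cases i
    simp
  pairwise_not_associated := Subsingleton.pairwise
  hasNoFixedPrimeDivisor p hp := by
    rw [polyRootCountMod_X hp]
    exact hp.one_lt

/-! ### Two-sided eventual bounds for the `(X)`-layer -/

/-- **Lower bound**: for every `c < log((1+δ)/(1−δ))`, eventually
`Φ(x, x^{(1−δ)/2}) > π(x) + c·x/log x`. [folklore] -/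
theorem layer_X_eventually_gt {δ c : ℝ} (hδ0 : 0 ≤ δ) (hδ : δ ≤ 1 / 4)
    (hc : c < Real.log ((1 + δ) / (1 - δ))) :
    ∀ᶠ x : ℕ in atTop, (Nat.primeCounting x : ℝ) + c * x / Real.log x <
      #(roughIcc ⌈(x : ℝ) ^ ((1 - δ) / 2)⌉₊ x) := by
  filter_upwards [eventually_mul_div_log_lt (tendsto_layer_X hδ0 hδ) hc] with x hx
  linarith

/-- **Upper bound**: for every `c > log((1+δ)/(1−δ))`, eventually
`Φ(x, x^{(1−δ)/2}) < π(x) + c·x/log x`. [folklore] -/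
theorem layer_X_eventually_lt {δ c : ℝ} (hδ0 : 0 ≤ δ) (hδ : δ ≤ 1 / 4)
    (hc : Real.log ((1 + δ) / (1 - δ)) < c) :
    ∀ᶠ x : ℕ in atTop, (#(roughIcc ⌈(x : ℝ) ^ ((1 - δ) / 2)⌉₊ x) : ℝ) <
      (Nat.primeCounting x : ℝ) + c * x / Real.log x := by
  filter_upwards [eventually_lt_mul_div_log (tendsto_layer_X hδ0 hδ) hc] with x hx
  linarith

/-! ### Tightness of the crux inequality at `(X)` -/

/-- **Tightness**: if the crux inequality holds eventually for the system `(X)` with the pair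
`(ε, δ)`, `0 ≤ δ ≤ 1/4`, then `log((1+δ)/(1−δ)) ≤ ε`. [folklore] -/
theorem log_ratio_le_of_eventually_cruxIneq_X {δ ε : ℝ} (hδ0 : 0 ≤ δ) (hδ : δ ≤ 1 / 4)
    (h : ∀ᶠ x : ℕ in atTop,
      (((Icc 1 x).filter (fun n : ℕ => ∀ i, 0 < (![(X : ℤ[X])] i).eval (n : ℤ) ∧
        ∀ p ∈ range ⌈(x : ℝ) ^ (((![(X : ℤ[X])] i).natDegree : ℝ) * (1 - δ) / 2)⌉₊,
          p.Prime → ¬ ((p : ℤ) ∣ (![(X : ℤ[X])] i).eval (n : ℤ)))).card : ℝ) ≤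
        (polyPrimeCount ![(X : ℤ[X])] x : ℝ) + ε * (x : ℝ) / Real.log x ^ 1) :
    Real.log ((1 + δ) / (1 - δ)) ≤ ε := by
  by_contra hlt
  push Not at hlt
  obtain ⟨x, hx1, hx2⟩ := (h.and (layer_X_eventually_gt hδ0 hδ hlt)).exists
  rw [card_cruxFilter_X, polyPrimeCount_X, pow_one] at hx1
  linarith

/-- **Sharp corollary `2δ ≤ ε`** for every admissible pair at `(X)` — the heuristic threshold
`2kδ·C(f)/∏deg fᵢ ≤ ε` at `k = 1`, `C(X) = 1`. [folklore] -/
theorem two_mul_delta_le_of_eventually_cruxIneq_X {δ ε : ℝ} (hδ0 : 0 ≤ δ) (hδ : δ ≤ 1 / 4)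
    (h : ∀ᶠ x : ℕ in atTop,
      (((Icc 1 x).filter (fun n : ℕ => ∀ i, 0 < (![(X : ℤ[X])] i).eval (n : ℤ) ∧
        ∀ p ∈ range ⌈(x : ℝ) ^ (((![(X : ℤ[X])] i).natDegree : ℝ) * (1 - δ) / 2)⌉₊,
          p.Prime → ¬ ((p : ℤ) ∣ (![(X : ℤ[X])] i).eval (n : ℤ)))).card : ℝ) ≤
        (polyPrimeCount ![(X : ℤ[X])] x : ℝ) + ε * (x : ℝ) / Real.log x ^ 1) :
    2 * δ ≤ ε :=
  (two_mul_le_log_ratio hδ0 (by linarith)).trans (log_ratio_le_of_eventually_cruxIneq_X hδ0 hδ h)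

/-- **The crux's conclusion HOLDS at `(X)`** with `δ(ε) = min (1/4) (ε/4)`
(`log((1+δ)/(1−δ)) ≤ 2δ/(1−δ) ≤ (8/3)δ < ε`). [folklore] -/
theorem cruxConclusion_X (ε : ℝ) (hε : 0 < ε) :
    ∃ δ : ℝ, 0 < δ ∧ δ ≤ 1 / 4 ∧ ∀ᶠ x : ℕ in atTop,
      (((Icc 1 x).filter (fun n : ℕ => ∀ i, 0 < (![(X : ℤ[X])] i).eval (n : ℤ) ∧
        ∀ p ∈ range ⌈(x : ℝ) ^ (((![(X : ℤ[X])] i).natDegree : ℝ) * (1 - δ) / 2)⌉₊,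
          p.Prime → ¬ ((p : ℤ) ∣ (![(X : ℤ[X])] i).eval (n : ℤ)))).card : ℝ) ≤
        (polyPrimeCount ![(X : ℤ[X])] x : ℝ) + ε * (x : ℝ) / Real.log x ^ 1 := by
  refine ⟨min (1 / 4) (ε / 4), by positivity, min_le_left _ _, ?_⟩
  set δ : ℝ := min (1 / 4) (ε / 4) with hδ_def
  have hδ0 : 0 < δ := by positivity
  have hδ : δ ≤ 1 / 4 := min_le_left _ _
  have hδε : δ ≤ ε / 4 := min_le_right _ _
  have hlog : Real.log ((1 + δ) / (1 - δ)) < ε := by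
    have h1 := Real.log_le_sub_one_of_pos
      (show 0 < (1 + δ) / (1 - δ) from div_pos (by linarith) (by linarith))
    have h2 : (1 + δ) / (1 - δ) - 1 ≤ 8 / 3 * δ := by
      rw [sub_le_iff_le_add, div_le_iff₀ (by linarith)]
      nlinarith
    linarith
  filter_upwards [layer_X_eventually_lt hδ0.le hδ hlog] with x hx
  rw [card_cruxFilter_X, polyPrimeCount_X, pow_one]
  exact hx.le

end Summit.Parity.BatemanHorn.Theorems.BalancedSemiprimeLayer.Negative
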